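import Summits.CriticalPhenomena.PercolationContinuityZ3.Theorems.PercNearOneGluingNoHeavyLowerTailKNGoodGMgcSideCells
import HarnessLib

/-!
# Target algebra: the symbolic bookkeeping behind `Φ(K/B, o*; j) = Σ_v phiCoef j r v X · v`
# (`NoHeavyLowerTail` cell, stmt-CriticalPhenomena-4575; prover `prim-hp-2`, gen 19 — brick L5b of the semantic layer of THEOREM B,
# memo `run/shared/lean/prim/prim-hp-2/MEMO-gen17-lean-certificates.md` §4')

Support file (`--supports stmt-CriticalPhenomena-4575`; imports the COMPUTATIONAL `…KNGoodGMgcSideGlue`; one finite check by `native_decide`).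
Small computable definitions (formal integer combinations of the fifteen glued-core reliabilities `rel π (relay i)` and their tie normal
form; the semantic descriptor `semF` of a deterministic side; `zonly/gz/P0`) + bookkeeping lemmas; no named facts, no sorries.
* `bexpR_eq_of_agree`, `bexpR_finset_sum`, `bexp_update_false_of_zero` (a weight-`0` bit is surely off), `bexp_congr_weights_of_dep`
  (an expectation reads only the weights of the bits its integrand reads).
* `FC` = formal combinations `ℕ → ℕ → ℤ` (world mask `π ∈ {0,3,5,6,7}`, relay index `i ∈ {1,2,3}`); `Verts.evalF` evaluates them at the
  reliabilities; `nf` = the tie normal form (`[12]: a₂→a₁`, `[13]: a₃→a₁`, `[23]: a₃→a₂`, `[123]: all→a₁`), `Verts.evalF_nf`; `vexp` = the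
  five core scalars `(α,β,γ,δ,ε)` as formal combinations, `Verts.evalF_vexp`.
* `semF j r c` — the formal value of THEOREM B's goodness integrand at the deterministic side `c` (picked relay, witness `j`, pocket
  `{x,y,z}` ↦ `a₁`, pocket `{x,y}` distributed over the `z`-hair patterns with reference `r`); **`semCheck_all`**: for all `j, r ∈ {1,2,3}` and
  all configurations, `nf (semF j r c) = nf (vexp (phiHat j r c))` (`native_decide`, 9·2¹² cases) — the f-table / pocket rows of `…KNGoodGMgcCert.phiHat` ARE
  the cell values.
The sequel `…KNGoodGMgcTarget.lean` combines this with the cell evaluations of `…SideCells` into the target expansion.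
-/

noncomputable section

namespace Summit.CriticalPhenomena.PercolationContinuityZ3.Theorems

namespace KNGoodGMgc

open MeasureTheory Set Literature.Probability.LatticeModels Literature.Probability.Percolation KNGoodAux
open scoped Classical BigOperators

variable {n : ℕ}

/-! ## More `bexp` / `bexpR` bookkeeping -/

/-- `bexpR m` evaluates its integrand only at configurations vanishing from bit `m` on. [folklore] -/
theorem bexpR_eq_of_agree : ∀ (m : ℕ) (F G : Cfg → ℝ), (∀ c : Cfg, (∀ k, m ≤ k → c k = false) → F c = G c) →
    ∀ x : ℕ → ℝ, bexpR m F x = bexpR m G x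
  | 0, F, G, h, x => by rw [bexpR_zero, bexpR_zero]; exact h _ (fun _ _ => rfl)
  | m + 1, F, G, h, x => by
    rw [bexpR_succ, bexpR_succ]
    have key : ∀ b : Bool, bexpR m (fun c => F (Function.update c m b)) x = bexpR m (fun c => G (Function.update c m b)) x :=
      fun b => bexpR_eq_of_agree m _ _ (fun c hc => h _ fun k hk => by
        rw [Function.update_of_ne (Nat.ne_of_gt (Nat.lt_of_succ_le hk))]
        exact hc k (Nat.le_of_succ_le hk)) x
    rw [key false, key true]

/-- `bexpR` of the zero function. [folklore] -/
theorem bexpR_zero_fun : ∀ (m : ℕ) (x : ℕ → ℝ), bexpR m (fun _ => (0 : ℝ)) x = 0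
  | 0, x => rfl
  | m + 1, x => by rw [bexpR_succ, bexpR_zero_fun m x]; ring

/-- `bexpR` commutes with finite sums. [folklore] -/
theorem bexpR_finset_sum {ι : Type*} (s : Finset ι) (m : ℕ) (F : ι → Cfg → ℝ) (x : ℕ → ℝ) :
    bexpR m (fun c => ∑ i ∈ s, F i c) x = ∑ i ∈ s, bexpR m (F i) x := by
  induction s using Finset.induction_on with
  | empty => simp [bexpR_zero_fun]
  | insert a s ha ih =>
    simp only [Finset.sum_insert ha]
    rw [bexpR_add, ih]

/-- A bit of weight `0` is surely off: the integrand may be pre-composed with switching it off. [folklore] -/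
theorem bexp_update_false_of_zero (k : ℕ) (x : ℕ → ℝ) (hk : x k = 0) :
    ∀ (m : ℕ) (f : Cfg → ℤ), k < m → bexp m f x = bexp m (fun c => f (Function.update c k false)) x
  | 0, _, h => absurd h (Nat.not_lt_zero _)
  | m + 1, f, h => by
    rcases Nat.lt_succ_iff_lt_or_eq.1 h with hlt | rfl
    · rw [bexp_succ, bexp_succ]
      have hne : m ≠ k := Nat.ne_of_gt hlt
      have e : ∀ b : Bool, (fun c => f (Function.update (Function.update c m b) k false)) =
          fun c => (fun c' => f (Function.update c' k false)) (Function.update c m b) := by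
        intro b; funext c; simp only [Function.update_comm hne]
      rw [bexp_update_false_of_zero k x hk m _ hlt, bexp_update_false_of_zero k x hk m (fun c => f (Function.update c m true)) hlt]
      simp only [Function.update_comm hne]
    · rw [bexp_succ, bexp_succ, hk]
      simp only [sub_zero, one_mul, zero_mul, add_zero, Function.update_idem]

/-- An expectation reads only the weights of the bits its integrand reads. [folklore] -/
theorem bexp_congr_weights_of_dep (T : ℕ → Prop) (x x' : ℕ → ℝ) (hx : ∀ k, T k → x k = x' k) :
    ∀ (m : ℕ) (f : Cfg → ℤ), DepOn T f → bexp m f x = bexp m f x'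
  | 0, f, _ => by rw [bexp_zero, bexp_zero]
  | m + 1, f, hf => by
    have hdep : ∀ b : Bool, DepOn T (fun c => f (Function.update c m b)) := fun b c c' h =>
      hf _ _ fun i hi => by
        by_cases him : i = m
        · subst him; simp
        · simp only [Function.update_of_ne him]; exact h i hi
    by_cases hT : T m
    · rw [bexp_succ, bexp_succ, hx m hT, bexp_congr_weights_of_dep T x x' hx m _ (hdep false),
        bexp_congr_weights_of_dep T x x' hx m _ (hdep true)]
    · have hfm : DepOn (fun i => i ≠ m) f := fun c c' h => hf c c' fun i hi => h i (fun him => hT (him ▸ hi))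
      rw [bexp_succ_of_dep m f hfm, bexp_succ_of_dep m f hfm]
      exact bexp_congr_weights_of_dep T x x' hx m f hf

/-! ## Formal combinations of the fifteen glued-core reliabilities -/

/-- A formal integer combination of the reliabilities `rel π (relay i)`, `π` a world mask, `i` a relay index. [this work] -/
abbrev FC := ℕ → ℕ → ℤ

/-- The single term `rel π (relay i)`. [this work] -/
def FC.single (π i : ℕ) : FC := fun π' i' => if π' = π ∧ i' = i then 1 else 0

/-- The tie normal form: in `[12]` move `a₂ ↦ a₁`, in `[13]` `a₃ ↦ a₁`, in `[23]` `a₃ ↦ a₂`, in `[123]` everything `↦ a₁`. [this work] -/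
def nf (L : FC) : FC := fun π i =>
  if π = 3 then (if i = 1 then L 3 1 + L 3 2 else if i = 2 then 0 else L 3 i)
  else if π = 5 then (if i = 1 then L 5 1 + L 5 3 else if i = 3 then 0 else L 5 i)
  else if π = 6 then (if i = 2 then L 6 2 + L 6 3 else if i = 3 then 0 else L 6 i)
  else if π = 7 then (if i = 1 then L 7 1 + L 7 2 + L 7 3 else if i = 2 ∨ i = 3 then 0 else L 7 i)
  else L π i

/-- Two formal combinations agree on the fifteen relevant indices. [this work] -/
def feq (L L' : FC) : Bool :=
  [0, 3, 5, 6, 7].all fun π => [1, 2, 3].all fun i => L π i == L' π i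

/-- The five core scalars `(α,β,γ,δ,ε)` weighted by `w`, as a formal combination:
`α = rel 0 a₂ − rel 0 a₁`, `β = rel 0 a₃ − rel 0 a₂`, `γ = rel 5 a₁ − rel 5 a₂`, `δ = rel 6 a₂ − rel 6 a₁`, `ε = rel 3 a₁ − rel 3 a₃`. [this work] -/
def vexp (w : Fin 5 → ℤ) : FC :=
  w 0 • (FC.single 0 2 - FC.single 0 1) + w 1 • (FC.single 0 3 - FC.single 0 2) + w 2 • (FC.single 5 1 - FC.single 5 2) +
    w 3 • (FC.single 6 2 - FC.single 6 1) + w 4 • (FC.single 3 1 - FC.single 3 3)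

/-- The configuration keeping only the `z`-hair bits `6,7,8`. [this work] -/
def zonly (c : Cfg) : Cfg := mk12 false false false false false false (c 6) (c 7) (c 8) false false false

/-- Indicator that the lone star `z` generates the world `π`. [this work] -/
def gz (π : ℕ) (c : Cfg) : ℤ := qHat [π] (zonly c)

/-- Indicator of the pocket `{x,y}`: no hair at `x` or `y`, both `z`-pairs closed. [this work] -/
def P0 (c : Cfg) : ℤ :=
  if (!(c 0) && !(c 1) && !(c 2) && !(c 3) && !(c 4) && !(c 5) && !(c 9) && !(c 10)) = true then 1 else 0

/-- The formal value of the goodness integrand at the deterministic side `c` (witness index `j`, reference index `r`):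
`[pick ≠ 0]·rel σ (pick) − rel σ j + [pick = 0, a z-pair open]·rel 0 a₁ + [pocket {x,y}]·Σ_π gz π · rel π r`, `σ = sideWorld (cplus c)`. [this work] -/
def semF (j r : ℕ) (c : Cfg) : FC :=
  (if pick c ≠ 0 then FC.single (sideWorld (cplus c)) (pick c) else 0) - FC.single (sideWorld (cplus c)) j +
    (if pick c = 0 ∧ (c 9 || c 10) = true then FC.single 0 1 else 0) +
    P0 c • (gz 0 c • FC.single 0 r + gz 3 c • FC.single 3 r + gz 5 c • FC.single 5 r + gz 6 c • FC.single 6 r +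
      gz 7 c • FC.single 7 r)

/-- The finite check: the semantic descriptor and `phiHat` agree in tie normal form. [this work] -/
def semCheck (j r : ℕ) (c : Cfg) : Bool := feq (nf (semF j r c)) (nf (vexp (phiHat j r c)))

/-- **`semCheck` holds** for all `j, r ∈ {1,2,3}` and all twelve-bit configurations (COMPUTATIONAL, `native_decide`). [this work] -/
theorem semCheck_all : ∀ b0 b1 b2 b3 b4 b5 b6 b7 b8 b9 b10 b11 : Bool,
    ([1, 2, 3].all fun j => [1, 2, 3].all fun r => semCheck j r (mk12 b0 b1 b2 b3 b4 b5 b6 b7 b8 b9 b10 b11)) = true := by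
  native_decide


/-! ## Evaluating formal combinations at the glued-core reliabilities -/

/-- `pick c ∈ {0,1,2,3}`. [this work] -/
theorem pick_cases (c : Cfg) : pick c = 0 ∨ pick c = 1 ∨ pick c = 2 ∨ pick c = 3 := by
  unfold pick; split_ifs <;> simp

namespace Verts

variable (V : Verts n) (u : Sym2 (Fin n) → unitInterval) (b : Fin n)

/-- The reliability `rel π (relay i)`. [this work] -/
def R (π i : ℕ) : ℝ := V.rel u b π (V.relay i)

/-- Evaluation of a formal combination at the fifteen reliabilities (explicit sum). [this work] -/
def evalF (L : FC) : ℝ :=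
  (L 0 1 : ℝ) * V.R u b 0 1 + (L 0 2 : ℝ) * V.R u b 0 2 + (L 0 3 : ℝ) * V.R u b 0 3 +
  (L 3 1 : ℝ) * V.R u b 3 1 + (L 3 2 : ℝ) * V.R u b 3 2 + (L 3 3 : ℝ) * V.R u b 3 3 +
  (L 5 1 : ℝ) * V.R u b 5 1 + (L 5 2 : ℝ) * V.R u b 5 2 + (L 5 3 : ℝ) * V.R u b 5 3 +
  (L 6 1 : ℝ) * V.R u b 6 1 + (L 6 2 : ℝ) * V.R u b 6 2 + (L 6 3 : ℝ) * V.R u b 6 3 +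
  (L 7 1 : ℝ) * V.R u b 7 1 + (L 7 2 : ℝ) * V.R u b 7 2 + (L 7 3 : ℝ) * V.R u b 7 3

/-- `evalF` is additive. [this work] -/
theorem evalF_add (L M : FC) : V.evalF u b (L + M) = V.evalF u b L + V.evalF u b M := by
  simp only [evalF, Pi.add_apply]; push_cast; ring

/-- `evalF` respects subtraction. [this work] -/
theorem evalF_sub (L M : FC) : V.evalF u b (L - M) = V.evalF u b L - V.evalF u b M := by
  simp only [evalF, Pi.sub_apply]; push_cast; ring

/-- `evalF` is homogeneous. [this work] -/
theorem evalF_smul (k : ℤ) (L : FC) : V.evalF u b (k • L) = (k : ℝ) * V.evalF u b L := by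
  simp only [evalF, Pi.smul_apply, smul_eq_mul]; push_cast; ring

/-- `evalF 0 = 0`. [this work] -/
theorem evalF_zero : V.evalF u b 0 = 0 := by
  simp [evalF]

/-- `evalF` of a single term. [this work] -/
theorem evalF_single (π i : ℕ) (hπ : π = 0 ∨ π = 3 ∨ π = 5 ∨ π = 6 ∨ π = 7) (hi : i = 1 ∨ i = 2 ∨ i = 3) :
    V.evalF u b (FC.single π i) = V.R u b π i := by
  rcases hπ with rfl | rfl | rfl | rfl | rfl <;> rcases hi with rfl | rfl | rfl <;> simp [evalF, FC.single]

/-- Combinations that agree on the fifteen indices evaluate equally. [this work] -/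
theorem evalF_congr_of_feq (L M : FC) (h : feq L M = true) : V.evalF u b L = V.evalF u b M := by
  simp only [feq, List.all_cons, List.all_nil, Bool.and_true, Bool.and_eq_true, beq_iff_eq] at h
  obtain ⟨⟨h01, h02, h03⟩, ⟨h31, h32, h33⟩, ⟨h51, h52, h53⟩, ⟨h61, h62, h63⟩, ⟨h71, h72, h73⟩⟩ := h
  simp only [evalF, h01, h02, h03, h31, h32, h33, h51, h52, h53, h61, h62, h63, h71, h72, h73]

/-- **The tie normal form does not change the value** (glued relays are equally reliable). [this work] -/
theorem evalF_nf (L : FC) : V.evalF u b (nf L) = V.evalF u b L := by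
  have t12 : V.R u b 3 2 = V.R u b 3 1 := (V.rel_tie_12 u b).symm
  have t13 : V.R u b 5 3 = V.R u b 5 1 := (V.rel_tie_13 u b).symm
  have t23 : V.R u b 6 3 = V.R u b 6 2 := (V.rel_tie_23 u b).symm
  have t7a : V.R u b 7 2 = V.R u b 7 1 := (V.rel_tie_123a u b).symm
  have t7b : V.R u b 7 3 = V.R u b 7 1 := (V.rel_tie_123b u b).symm
  simp only [evalF, nf]
  norm_num
  rw [t12, t13, t23, t7a, t7b]
  ring

/-- `evalF` of the five-scalar combination. [this work] -/
theorem evalF_vexp (w : Fin 5 → ℤ) :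
    V.evalF u b (vexp w) =
      (w 0 : ℝ) * (V.R u b 0 2 - V.R u b 0 1) + (w 1 : ℝ) * (V.R u b 0 3 - V.R u b 0 2) + (w 2 : ℝ) * (V.R u b 5 1 - V.R u b 5 2) +
        (w 3 : ℝ) * (V.R u b 6 2 - V.R u b 6 1) + (w 4 : ℝ) * (V.R u b 3 1 - V.R u b 3 3) := by
  simp only [vexp, evalF_add, evalF_sub, evalF_smul]
  rw [V.evalF_single u b 0 2 (by norm_num) (by norm_num), V.evalF_single u b 0 1 (by norm_num) (by norm_num),
    V.evalF_single u b 0 3 (by norm_num) (by norm_num), V.evalF_single u b 5 1 (by norm_num) (by norm_num),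
    V.evalF_single u b 5 2 (by norm_num) (by norm_num), V.evalF_single u b 6 2 (by norm_num) (by norm_num),
    V.evalF_single u b 6 1 (by norm_num) (by norm_num), V.evalF_single u b 3 1 (by norm_num) (by norm_num),
    V.evalF_single u b 3 3 (by norm_num) (by norm_num)]

/-- **`evalF` of the semantic descriptor.** [this work] -/
theorem evalF_semF (j r : ℕ) (hj : j = 1 ∨ j = 2 ∨ j = 3) (hr : r = 1 ∨ r = 2 ∨ r = 3) (c : Cfg) :
    V.evalF u b (semF j r c) =
      (if pick c ≠ 0 then V.R u b (sideWorld (cplus c)) (pick c) else 0) - V.R u b (sideWorld (cplus c)) j +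
        (if pick c = 0 ∧ (c 9 || c 10) = true then V.R u b 0 1 else 0) +
        (P0 c : ℝ) * ((gz 0 c : ℝ) * V.R u b 0 r + (gz 3 c : ℝ) * V.R u b 3 r + (gz 5 c : ℝ) * V.R u b 5 r +
          (gz 6 c : ℝ) * V.R u b 6 r + (gz 7 c : ℝ) * V.R u b 7 r) := by
  have hσ := sideWorld_cases (cplus c)
  have e1 : V.evalF u b (if pick c ≠ 0 then FC.single (sideWorld (cplus c)) (pick c) else 0) =
      (if pick c ≠ 0 then V.R u b (sideWorld (cplus c)) (pick c) else 0) := by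
    split_ifs with hp
    · rcases pick_cases c with h | h | h | h
      · exact absurd h hp
      · exact V.evalF_single u b _ _ hσ (Or.inl h)
      · exact V.evalF_single u b _ _ hσ (Or.inr (Or.inl h))
      · exact V.evalF_single u b _ _ hσ (Or.inr (Or.inr h))
    · exact V.evalF_zero u b
  have e2 : V.evalF u b (if pick c = 0 ∧ (c 9 || c 10) = true then FC.single 0 1 else 0) =
      (if pick c = 0 ∧ (c 9 || c 10) = true then V.R u b 0 1 else 0) := by
    split_ifs
    · exact V.evalF_single u b 0 1 (by norm_num) (by norm_num)
    · exact V.evalF_zero u b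
  rw [semF, V.evalF_add, V.evalF_add, V.evalF_sub, e1, e2, V.evalF_smul, V.evalF_add, V.evalF_add, V.evalF_add, V.evalF_add,
    V.evalF_smul, V.evalF_smul, V.evalF_smul, V.evalF_smul, V.evalF_smul,
    V.evalF_single u b _ j hσ hj, V.evalF_single u b 0 r (by norm_num) hr, V.evalF_single u b 3 r (by norm_num) hr,
    V.evalF_single u b 5 r (by norm_num) hr, V.evalF_single u b 6 r (by norm_num) hr, V.evalF_single u b 7 r (by norm_num) hr]

end Verts

end KNGoodGMgc

end Summit.CriticalPhenomena.PercolationContinuityZ3.Theorems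

end
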